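import Summits.NavierStokesRegularity.NavierStokesRegularity.Theorems.SwirlHolderTowerAlgebraicFunnel
import HarnessLib

/-!
# SwirlHolderTower, part 4c — sharp-order gauge of the algebraic funnel family and the
# UNCONDITIONAL ceiling `γ(N) ≲ 8/N`: no polynomial linear Hölder law with `p < 1` (seat nsreg-p4)

Support file for the DORMANT route `SwirlThreshold` (crux stmt-NavierStokesRegularity-2002),
planner nsreg-p2's ROUND-15.  Part 4b built the exact algebraic family (odd polynomial profiles
`L_j`, `(1-t²)L' + (m-2)tL = 1`, `m = 2j+3`; exact swirl `|x|^{2/m} sin²ϑ`) with the CRUDE gauge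
`≈ m²`, giving `¬ LinearHolderLaw (c(1+N)^{-p})` for `p < 1/2`.  Here the gauge is brought to its
true order `≈ m` by two maximum-principle / monotonicity arguments on the angular equation, both
with EXPLICIT derivatives (the `L`-terms cancel):

* `profile_le_div` (M1): `L ≤ t/(1-t²)` on `[0,1)` — `V = t/(1-t²) - L` has
  `V' = (2t² + (m-2)t(1-t²)L)/(1-t²)² ≥ 0`;
* `weightedDefect_monotoneOn` (M2): `Z = (4 - (m-1)tL)·t⁻¹(1-t²)^{-(m-2)/2}` has
  `Z' = t⁻²(1-t²)^{-m/2}(3(m-1)t² - 4) ≥ 0` past `t² ≥ 4/(3(m-1))`;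
* `profile_weight_le_four`: `0 ≤ (m-1) t L(t) ≤ 4` on `[0,1]` (crude region `(m+3)t² ≤ 4` by (M1),
  the rest by (M2); the true supremum is `≈ 1.3`), hence `family_gauge_sharp`:
  `|α| + |k| ≤ 4c = 4(m-1)(m+2)/m` and `isSteadyPassiveSwirl_family_sharp`;
* `linearHolderLaw_exponent_le_of_pair` (the ceiling mechanism for `Θ = |x|^g sin²ϑ`),
  `linearHolderLaw_exponent_le_algebraic_sharp`: **`γ(N_j) ≤ 2/(2j+3)` at
  `N_j = 4(2j+2)(2j+5)/(2j+3) ≈ 8j`**;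
* `not_linearPolyHolderLaw_of_lt_one`: **for every `0 < p < 1`, `c > 0`, the law `c(1+N)^{-p}`
  FAILS on the linear class — unconditionally.**

So, in kernel and without any hypothesis: LINEAR (passive-scalar, critical-drift) methods cannot
yield a Hölder exponent decaying slower than `1/N`; the EXPONENTIAL rate `e^{-N/4}` (every `p`,
and the `(log log)^c → (log)^c` discussion of ROUND-15) still rests on `FunnelExponent`.
WHAT THIS IS NOT: not NS regularity — explicit steady divergence-free drifts (not NS flows) with
exact passive swirls; `PolyHolderLaw` for Navier–Stokes and all hard cores untouched; no crux claim.
-/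

namespace Summit.NavierStokesRegularity.NavierStokesRegularity.Theorems.SwirlHolderTower

open Set Filter Topology Metric
open scoped Laplacian RealInnerProductSpace
open Literature.Analysis Literature.Analysis.FluidPDE

noncomputable section


section SharpGauge

variable {L : ℝ → ℝ} {m : ℝ}

/-- `L(0) = 0` for an odd profile. -/
theorem profile_zero (hodd : ∀ t : ℝ, L (-t) = -L t) : L 0 = 0 := by
  have h := hodd 0
  rw [neg_zero] at h
  linarith

/-- **(M1) `L ≤ t/(1-t²)` on `[0,1)`**: `V = t/(1-t²) - L` is nondecreasing, since by the angular
equation `V' = (2t² + (m-2)t(1-t²)L)/(1-t²)² ≥ 0` (`L ≥ 0` on `[0,1]`, `m ≥ 2`). -/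
theorem profile_le_div (hL : ContDiff ℝ 2 L)
    (hode : ∀ t : ℝ, (1 - t ^ 2) * deriv L t + (m - 2) * t * L t = 1)
    (hbd : ∀ t ∈ Icc (0 : ℝ) 1, 0 ≤ L t ∧ L t ≤ 1) (hodd : ∀ t : ℝ, L (-t) = -L t) (hm : 2 ≤ m)
    {t : ℝ} (ht : t ∈ Ico (0 : ℝ) 1) : L t ≤ t / (1 - t ^ 2) := by
  have hLc : Continuous L := hL.continuous
  have hLd : ∀ s, HasDerivAt L (deriv L s) s := fun s => ((hL.differentiable (by norm_num)) s).hasDerivAt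
  have hne : ∀ s ∈ Icc (0 : ℝ) t, 1 - s ^ 2 ≠ 0 := by
    intro s hs; have : s ^ 2 < 1 := by nlinarith [hs.1, hs.2, ht.2]
    linarith
  have hV : ∀ s : ℝ, 1 - s ^ 2 ≠ 0 → HasDerivAt (fun s : ℝ => s / (1 - s ^ 2) - L s)
      ((1 * (1 - s ^ 2) - s * (-(2 * s))) / (1 - s ^ 2) ^ 2 - deriv L s) s := by
    intro s hs1
    have h1 : HasDerivAt (fun s : ℝ => 1 - s ^ 2) (-(2 * s)) s := by
      simpa using (hasDerivAt_pow 2 s).const_sub 1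
    exact ((hasDerivAt_id s).div h1 hs1).sub (hLd s)
  have key : MonotoneOn (fun s : ℝ => s / (1 - s ^ 2) - L s) (Icc 0 t) := by
    apply monotoneOn_of_deriv_nonneg (convex_Icc 0 t)
    · exact ((continuousOn_id.div (continuousOn_const.sub (continuousOn_id.pow 2)) hne).sub
        hLc.continuousOn)
    · intro s hs
      rw [interior_Icc] at hs
      exact (hV s (hne s ⟨hs.1.le, hs.2.le⟩)).differentiableAt.differentiableWithinAt
    · intro s hs
      rw [interior_Icc] at hs
      have hs0 : 0 ≤ s := hs.1.le
      have hs1' : 0 < 1 - s ^ 2 := by nlinarith [hs.1, hs.2, ht.2]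
      have hs1 : 1 - s ^ 2 ≠ 0 := hs1'.ne'
      rw [(hV s hs1).deriv]
      have hLs : 0 ≤ L s := (hbd s ⟨hs0, by linarith [hs.2, ht.2]⟩).1
      have hL' : deriv L s = (1 - (m - 2) * s * L s) / (1 - s ^ 2) := by
        rw [eq_div_iff hs1]; linear_combination hode s
      rw [hL']
      have hnum : 0 ≤ 2 * s ^ 2 + (m - 2) * s * (1 - s ^ 2) * L s := by
        have : 0 ≤ (m - 2) * s * (1 - s ^ 2) * L s := by
          apply mul_nonneg (mul_nonneg (mul_nonneg (by linarith) hs0) hs1'.le) hLs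
        nlinarith
      have : (1 * (1 - s ^ 2) - s * (-(2 * s))) / (1 - s ^ 2) ^ 2 - (1 - (m - 2) * s * L s) / (1 - s ^ 2) =
          (2 * s ^ 2 + (m - 2) * s * (1 - s ^ 2) * L s) / (1 - s ^ 2) ^ 2 := by
        field_simp; ring
      rw [this]; positivity
  have h := key ⟨le_refl 0, ht.1⟩ ⟨ht.1, le_refl t⟩ ht.1
  simp only [profile_zero hodd] at h
  norm_num at h
  linarith

/-- **(M2) the weighted defect `Z = (4 - (m-1)tL)·t⁻¹(1-t²)^{-(m-2)/2}` is nondecreasing on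
`[t₀, t₁] ⊂ (0,1)` once `3(m-1)t₀² ≥ 4`**: by the angular equation all `L`-terms cancel in
`Z' = t⁻²(1-t²)^{-m/2}(3(m-1)t² - 4)`. -/
theorem weightedDefect_monotoneOn (hL : ContDiff ℝ 2 L)
    (hode : ∀ t : ℝ, (1 - t ^ 2) * deriv L t + (m - 2) * t * L t = 1)
    {t₀ t₁ : ℝ} (h0 : 0 < t₀) (h1 : t₁ < 1) (hthr : 4 ≤ 3 * (m - 1) * t₀ ^ 2) :
    MonotoneOn (fun s : ℝ => (4 - (m - 1) * s * L s) * (s⁻¹ * (1 - s ^ 2) ^ (-((m - 2) / 2))))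
      (Icc t₀ t₁) := by
  have hLc : Continuous L := hL.continuous
  have hLd : ∀ s, HasDerivAt L (deriv L s) s := fun s => ((hL.differentiable (by norm_num)) s).hasDerivAt
  have hpos : ∀ s ∈ Icc t₀ t₁, 0 < s ∧ 0 < 1 - s ^ 2 := by
    intro s hs
    refine ⟨lt_of_lt_of_le h0 hs.1, ?_⟩
    have : s ^ 2 < 1 := by nlinarith [hs.1, hs.2]
    linarith
  -- derivative of `Z` at interior points
  have hderiv : ∀ s, 0 < s → 0 < 1 - s ^ 2 →
      HasDerivAt (fun s : ℝ => (4 - (m - 1) * s * L s) * (s⁻¹ * (1 - s ^ 2) ^ (-((m - 2) / 2))))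
        ((1 - s ^ 2) ^ (-((m - 2) / 2) - 1) * (s ^ 2)⁻¹ * (3 * (m - 1) * s ^ 2 - 4)) s := by
    intro s hs0 hs1
    have hW : HasDerivAt (fun s : ℝ => 4 - (m - 1) * s * L s)
        (-((m - 1) * (1 * L s + s * deriv L s))) s := by
      have := (((hasDerivAt_id s).mul (hLd s)).const_mul (m - 1)).const_sub 4
      simpa [mul_assoc] using this
    have h1s : HasDerivAt (fun s : ℝ => 1 - s ^ 2) (-(2 * s)) s := by
      simpa using (hasDerivAt_pow 2 s).const_sub 1
    have hμ : HasDerivAt (fun s : ℝ => s⁻¹ * (1 - s ^ 2) ^ (-((m - 2) / 2)))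
        (-(s ^ 2)⁻¹ * (1 - s ^ 2) ^ (-((m - 2) / 2)) +
          s⁻¹ * (-(2 * s) * (-((m - 2) / 2)) * (1 - s ^ 2) ^ (-((m - 2) / 2) - 1))) s :=
      (hasDerivAt_inv hs0.ne').mul (h1s.rpow_const (Or.inl hs1.ne'))
    have h := hW.mul hμ
    refine h.congr_deriv ?_
    have hL' : deriv L s = (1 - (m - 2) * s * L s) / (1 - s ^ 2) := by
      rw [eq_div_iff hs1.ne']; linear_combination hode s
    have hr : (1 - s ^ 2) ^ (-((m - 2) / 2)) = (1 - s ^ 2) ^ (-((m - 2) / 2) - 1) * (1 - s ^ 2) := by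
      rw [Real.rpow_sub_one hs1.ne', div_mul_cancel₀ _ hs1.ne']
    rw [hL', hr]
    field_simp
    ring
  apply monotoneOn_of_deriv_nonneg (convex_Icc t₀ t₁)
  · intro s hs
    obtain ⟨hs0, hs1⟩ := hpos s hs
    exact (hderiv s hs0 hs1).continuousAt.continuousWithinAt
  · intro s hs
    rw [interior_Icc] at hs
    obtain ⟨hs0, hs1⟩ := hpos s ⟨hs.1.le, hs.2.le⟩
    exact (hderiv s hs0 hs1).differentiableAt.differentiableWithinAt
  · intro s hs
    rw [interior_Icc] at hs
    obtain ⟨hs0, hs1⟩ := hpos s ⟨hs.1.le, hs.2.le⟩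
    rw [(hderiv s hs0 hs1).deriv]
    have h3 : 0 ≤ 3 * (m - 1) * s ^ 2 - 4 := by
      have hm1 : 0 ≤ 3 * (m - 1) := by nlinarith [sq_nonneg t₀, h0]
      nlinarith [mul_le_mul_of_nonneg_left (show t₀ ^ 2 ≤ s ^ 2 by nlinarith [hs.1, h0]) hm1]
    have h4 : 0 < (1 - s ^ 2) ^ (-((m - 2) / 2) - 1) := Real.rpow_pos_of_pos hs1 _
    positivity

/-- **SHARP-ORDER WEIGHT BOUND**: `0 ≤ (m-1) t L(t) ≤ 4` on `[0,1]` for `m ≥ 3`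
(true sup `≈ 1.3`; `= 2` at `m = 3`).  Crude region `(m+3)t² ≤ 4` by (M1), the rest by (M2). -/
theorem profile_weight_le_four (hL : ContDiff ℝ 2 L)
    (hode : ∀ t : ℝ, (1 - t ^ 2) * deriv L t + (m - 2) * t * L t = 1)
    (hbd : ∀ t ∈ Icc (0 : ℝ) 1, 0 ≤ L t ∧ L t ≤ 1) (hodd : ∀ t : ℝ, L (-t) = -L t) (hm : 3 ≤ m)
    {t : ℝ} (ht : t ∈ Icc (0 : ℝ) 1) : 0 ≤ (m - 1) * t * L t ∧ (m - 1) * t * L t ≤ 4 := by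
  have hLt : 0 ≤ L t := (hbd t ht).1
  refine ⟨mul_nonneg (mul_nonneg (by linarith) ht.1) hLt, ?_⟩
  -- the endpoint `t = 1`: `(m-2) L(1) = 1`
  rcases eq_or_lt_of_le ht.2 with h1 | h1
  · subst h1
    have h := hode 1
    norm_num at h
    -- h : (m - 2) * L 1 = 1
    have hm2 : 0 < m - 2 := by linarith
    have hL1 : L 1 = 1 / (m - 2) := by field_simp; linarith
    rw [hL1, mul_one, mul_one_div, div_le_iff₀ hm2]; linarith
  -- the crude region `(m+3) t² ≤ 4`, from (M1)
  have crude : ∀ s : ℝ, s ∈ Ico (0 : ℝ) 1 → (m + 3) * s ^ 2 ≤ 4 → (m - 1) * s * L s ≤ 4 := by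
    intro s hs hsm
    have hs1 : 0 < 1 - s ^ 2 := by nlinarith [hs.1, hs.2]
    have hle := profile_le_div hL hode hbd hodd (by linarith) hs
    have : (m - 1) * s * L s ≤ (m - 1) * s * (s / (1 - s ^ 2)) :=
      mul_le_mul_of_nonneg_left hle (mul_nonneg (by linarith) hs.1)
    refine this.trans ?_
    rw [← mul_div_assoc, div_le_iff₀ hs1]
    nlinarith
  by_cases hsm : (m + 3) * t ^ 2 ≤ 4
  · exact crude t ⟨ht.1, h1⟩ hsm
  push Not at hsm
  -- the monotone region: from `t₀ = √(4/(m+3))` to `t`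
  set t₀ : ℝ := Real.sqrt (4 / (m + 3)) with ht₀
  have hm3 : 0 < m + 3 := by linarith
  have ht₀sq : t₀ ^ 2 = 4 / (m + 3) := Real.sq_sqrt (by positivity)
  have ht₀pos : 0 < t₀ := Real.sqrt_pos.2 (by positivity)
  have ht₀t : t₀ ≤ t := by
    rw [ht₀, Real.sqrt_le_left ht.1, div_le_iff₀ hm3]; linarith
  have ht₀1 : t₀ < 1 := lt_of_le_of_lt ht₀t h1
  have hthr : 4 ≤ 3 * (m - 1) * t₀ ^ 2 := by
    rw [ht₀sq, mul_div_assoc', le_div_iff₀ hm3]; nlinarith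
  have hmono := weightedDefect_monotoneOn hL hode ht₀pos h1 hthr
  have hZ := hmono ⟨le_refl t₀, ht₀t⟩ ⟨ht₀t, le_refl t⟩ ht₀t
  simp only at hZ
  -- `Z(t₀) ≥ 0` from the crude region, hence `Z(t) ≥ 0`, hence the bound
  have hW0 : 0 ≤ 4 - (m - 1) * t₀ * L t₀ := by
    have := crude t₀ ⟨ht₀pos.le, ht₀1⟩ (by rw [ht₀sq]; field_simp; rfl)
    linarith
  have hμpos : ∀ s : ℝ, 0 < s → s < 1 → 0 < s⁻¹ * (1 - s ^ 2) ^ (-((m - 2) / 2)) := by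
    intro s hs0 hs1
    have : 0 < 1 - s ^ 2 := by nlinarith
    exact mul_pos (inv_pos.2 hs0) (Real.rpow_pos_of_pos this _)
  have ht0' : 0 < t := lt_of_lt_of_le ht₀pos ht₀t
  have hZt : 0 ≤ (4 - (m - 1) * t * L t) * (t⁻¹ * (1 - t ^ 2) ^ (-((m - 2) / 2))) :=
    le_trans (mul_nonneg hW0 (hμpos t₀ ht₀pos ht₀1).le) hZ
  have := (mul_nonneg_iff_of_pos_right (hμpos t ht0' h1)).1 hZt
  linarith


/-- **SHARP-ORDER GAUGE of the family**: `|α(t)| + |k(t)| ≤ 4(m-1)(m+2)/m` on `[-1,1]`, `m ≥ 3`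
(linear in `m`; the crude part-4b gauge was quadratic). -/
theorem family_gauge_sharp (hm : 3 ≤ m) (hL : ContDiff ℝ 2 L)
    (hode : ∀ t : ℝ, (1 - t ^ 2) * deriv L t + (m - 2) * t * L t = 1)
    (hbd : ∀ t ∈ Icc (0 : ℝ) 1, 0 ≤ L t ∧ L t ≤ 1) (hodd : ∀ t : ℝ, L (-t) = -L t)
    {t : ℝ} (ht : t ∈ Icc (-1 : ℝ) 1) :
    |(-((m - 1) * (m + 2) / m * (1 - (m - 1) * t * L t)))| + |(m - 1) * (m + 2) / m * L t| ≤
      4 * ((m - 1) * (m + 2) / m) := by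
  have hm0 : 0 < m := by linarith
  have hc : 0 ≤ (m - 1) * (m + 2) / m := div_nonneg (mul_nonneg (by linarith) (by linarith)) hm0.le
  have hL1 : |L t| ≤ 1 := abs_profile_le_one hbd hodd ht
  -- `0 ≤ (m-1) t L(t) ≤ 4`, by symmetry from `[0,1]`
  have hw : 0 ≤ (m - 1) * t * L t ∧ (m - 1) * t * L t ≤ 4 := by
    rcases le_or_gt 0 t with h | h
    · exact profile_weight_le_four hL hode hbd hodd hm ⟨h, ht.2⟩
    · have h' := profile_weight_le_four hL hode hbd hodd hm (t := -t) ⟨by linarith, by linarith [ht.1]⟩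
      rw [hodd] at h'
      constructor <;> nlinarith [h'.1, h'.2]
  have h1 : |(-((m - 1) * (m + 2) / m * (1 - (m - 1) * t * L t)))| ≤ (m - 1) * (m + 2) / m * 3 := by
    rw [abs_neg, abs_mul, abs_of_nonneg hc]
    refine mul_le_mul_of_nonneg_left (abs_le.2 ⟨by linarith [hw.2], by linarith [hw.1]⟩) hc
  have h2 : |(m - 1) * (m + 2) / m * L t| ≤ (m - 1) * (m + 2) / m * 1 := by
    rw [abs_mul, abs_of_nonneg hc]; gcongr
  linarith

/-- **The algebraic funnel pair with the sharp-order gauge `4(m-1)(m+2)/m`.** -/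
theorem isSteadyPassiveSwirl_family_sharp (hm : 3 ≤ m) (hL : ContDiff ℝ 2 L)
    (hode : ∀ t : ℝ, (1 - t ^ 2) * deriv L t + (m - 2) * t * L t = 1)
    (hbd : ∀ t ∈ Icc (0 : ℝ) 1, 0 ≤ L t ∧ L t ≤ 1) (hodd : ∀ t : ℝ, L (-t) = -L t) :
    IsSteadyPassiveSwirl (4 * ((m - 1) * (m + 2) / m))
      (fun y : EuclideanSpace ℝ (Fin 3) =>
        ((fun t : ℝ => -((m - 1) * (m + 2) / m * (1 - (m - 1) * t * L t))) (y 2 / ‖y‖) *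
            (‖y‖ ^ 2) ^ (-1 : ℝ)) • y +
          ((fun t : ℝ => (m - 1) * (m + 2) / m * L t) (y 2 / ‖y‖) * (‖y‖ ^ 2) ^ (-(1 / 2 : ℝ))) •
            (EuclideanSpace.single 2 1 : EuclideanSpace ℝ (Fin 3)))
      (separableSwirl (2 / m) (fun t => 1 - t ^ 2)) := by
  obtain ⟨-, h2, h3, h4, h5, h6, h7⟩ := isSteadyPassiveSwirl_family hm hL hode hbd hodd
  refine ⟨fun x hx => ?_, h2, h3, h4, h5, h6, h7⟩
  refine (norm_streamDrift_le (fun t : ℝ => -((m - 1) * (m + 2) / m * (1 - (m - 1) * t * L t)))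
    (fun t : ℝ => (m - 1) * (m + 2) / m * L t) hx).trans ?_
  exact div_le_div_of_nonneg_right (family_gauge_sharp hm hL hode hbd hodd (div_norm_mem_Icc x))
    (norm_nonneg x)

end SharpGauge

/-! ### The unconditional ceiling at rate `1/N` -/

/-- From any steady passive swirl pair of gauge `N ≥ 0` carrying `Θ = |x|^g sin²ϑ` (`g > 0`), a
linear Hölder law has `γ(N) ≤ g` (the mechanism of `linearHolderLaw_ceiling`, with `t₀ = 0`,
`m = 1`). -/
theorem linearHolderLaw_exponent_le_of_pair {γ : ℝ → ℝ} (hlaw : LinearHolderLaw γ) {N g : ℝ}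
    (hN0 : 0 ≤ N) (hg0 : 0 < g) {b : EuclideanSpace ℝ (Fin 3) → EuclideanSpace ℝ (Fin 3)}
    (hpair : IsSteadyPassiveSwirl N b (separableSwirl g (fun t => 1 - t ^ 2))) : γ N ≤ g := by
  obtain ⟨K, hK, hlaw⟩ := hlaw
  have hconf : ∀ x ∈ closedBall (0 : EuclideanSpace ℝ (Fin 3)) 1,
      separableSwirl g (fun t => 1 - t ^ 2) x ∈ Icc (0 : ℝ) 1 := by
    intro x hx
    have hx1 : ‖x‖ ≤ 1 := by simpa using hx
    have ht := div_norm_mem_Icc x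
    have hG0 : 0 ≤ 1 - (x 2 / ‖x‖) ^ 2 := by nlinarith [ht.1, ht.2]
    have hG1 : 1 - (x 2 / ‖x‖) ^ 2 ≤ 1 := by nlinarith
    have hρ0 : 0 ≤ ‖x‖ ^ g := Real.rpow_nonneg (norm_nonneg x) g
    have hρ1 : ‖x‖ ^ g ≤ 1 := Real.rpow_le_one (norm_nonneg x) hx1 hg0.le
    refine ⟨mul_nonneg hρ0 hG0, ?_⟩
    calc ‖x‖ ^ g * (1 - (x 2 / ‖x‖) ^ 2) ≤ 1 * 1 := by gcongr
      _ = 1 := one_mul 1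
  have step : ∀ r : ℝ, 0 < r → r ≤ 1 → r ^ g ≤ K * (1 + N) ^ K * r ^ (γ N) := by
    intro r hr hr1
    obtain ⟨a', c', -, hconf', hlen⟩ := hlaw N hN0 _ _ hpair 0 1 zero_le_one hconf r hr hr1
    have h0mem : separableSwirl g (fun t => 1 - t ^ 2) 0 ∈ Icc a' c' := hconf' 0 (by simp [hr.le])
    rw [separableSwirl_zero hg0] at h0mem
    have ht₀ : (0 : ℝ) ∈ Icc (-1 : ℝ) 1 := by constructor <;> norm_num
    have hPmem : separableSwirl g (fun t => 1 - t ^ 2) (polarPoint r 0) ∈ Icc a' c' := by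
      apply hconf'
      simp [norm_polarPoint hr.le ht₀]
    rw [separableSwirl_polarPoint hr ht₀] at hPmem
    have h1 : r ^ g ≤ c' - a' := by nlinarith [hPmem.2, h0mem.1]
    calc r ^ g ≤ c' - a' := h1
      _ ≤ K * (1 + N) ^ K * r ^ γ N * (1 - 0) := hlen
      _ = K * (1 + N) ^ K * r ^ γ N := by ring
  have hK' : 0 < K * (1 + N) ^ K := by positivity
  exact exponent_le_of_rpow_le hK' step

/-- **UNCONDITIONAL CEILING at rate `1/N`**: every linear Hölder law has `γ(N_j) ≤ 2/(2j+3)` at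
`N_j = 4(2j+2)(2j+5)/(2j+3) ≈ 8j`, for all `j : ℕ` (`γ(N) ≲ 8/N` along the family). -/
theorem linearHolderLaw_exponent_le_algebraic_sharp {γ : ℝ → ℝ} (hlaw : LinearHolderLaw γ) (j : ℕ) :
    γ (4 * ((2 * j + 2) * (2 * j + 5) / (2 * j + 3))) ≤ 2 / (2 * j + 3) := by
  obtain ⟨L, hLs, hode, hbd, hodd⟩ := exists_odeProfile j
  set m : ℝ := 2 * j + 3 with hm
  have hj0 : (0:ℝ) ≤ j := Nat.cast_nonneg j
  have hm3 : 3 ≤ m := by rw [hm]; linarith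
  have hode' : ∀ t : ℝ, (1 - t ^ 2) * deriv L t + (m - 2) * t * L t = 1 := by
    intro t; rw [hm]; have := hode t; linear_combination this
  have hpair := isSteadyPassiveSwirl_family_sharp hm3 (hLs 2) hode' hbd hodd
  have hN : 4 * ((m - 1) * (m + 2) / m) = 4 * ((2 * j + 2) * (2 * j + 5) / (2 * j + 3)) := by
    rw [hm]; ring
  have hgm : 2 / m = 2 / (2 * j + 3) := by rw [hm]
  rw [hN, hgm] at hpair
  exact linearHolderLaw_exponent_le_of_pair hlaw (by positivity) (by positivity) hpair

/-- **NO POLYNOMIAL HÖLDER LAW WITH `p < 1` FOR PASSIVE SWIRLS — UNCONDITIONAL**: for every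
`0 < p < 1` and `c > 0` the law `c(1+N)^{-p}` fails on the linear class.  (Every `p > 0`:
`not_linearPolyHolderLaw`, conditional on `FunnelExponent`; `p < 1/2`: part 4b, crude gauge.) -/
theorem not_linearPolyHolderLaw_of_lt_one {p c : ℝ} (hp : 0 < p) (hp1 : p < 1) (hc : 0 < c) :
    ¬ LinearHolderLaw (fun N => c * (1 + N) ^ (-p)) := by
  intro hlaw
  set q : ℝ := 1 - p with hq
  have hq0 : 0 < q := by rw [hq]; linarith
  obtain ⟨j, hj⟩ := exists_nat_gt ((20 / c) ^ q⁻¹)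
  have hle := linearHolderLaw_exponent_le_algebraic_sharp hlaw j
  set N : ℝ := 4 * ((2 * j + 2) * (2 * j + 5) / (2 * j + 3)) with hN
  set M : ℝ := 2 * j + 5 with hM
  have hj0 : (0 : ℝ) ≤ j := Nat.cast_nonneg j
  have hM5 : 5 ≤ M := by rw [hM]; linarith
  have hM0 : 0 < M := by linarith
  have hN0 : 0 ≤ N := by positivity
  -- `1 + N ≤ 5M`
  have hN1 : 1 + N ≤ 5 * M := by
    have key : (2 * (j:ℝ) + 2) * (2 * j + 5) / (2 * j + 3) ≤ 2 * j + 5 := by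
      rw [div_le_iff₀ (by linarith)]; nlinarith
    rw [hN, hM]; nlinarith
  have h1 : (5 * M) ^ (-p) ≤ (1 + N) ^ (-p) :=
    Real.rpow_le_rpow_of_nonpos (by linarith) hN1 (by linarith)
  have h2 : (5 * M) ^ (-p) = (5:ℝ) ^ (-p) * (M ^ q / M) := by
    rw [Real.mul_rpow (by norm_num) hM0.le, ← Real.rpow_sub_one hM0.ne']
    congr 2; rw [hq]; ring
  have h5 : (1:ℝ) / 5 ≤ (5:ℝ) ^ (-p) := by
    rw [show (1:ℝ) / 5 = (5:ℝ) ^ (-1 : ℝ) by rw [Real.rpow_neg_one]; norm_num]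
    exact Real.rpow_le_rpow_of_exponent_le (by norm_num) (by linarith)
  have h3 : c * ((1 / 5) * (M ^ q / M)) ≤ 2 / (M - 2) := by
    have hj3 : (2 * (j:ℝ) + 3) = M - 2 := by rw [hM]; ring
    rw [← hj3]
    have hMq : 0 ≤ M ^ q / M := div_nonneg (Real.rpow_nonneg hM0.le q) hM0.le
    calc c * ((1 / 5) * (M ^ q / M)) ≤ c * ((5:ℝ) ^ (-p) * (M ^ q / M)) := by gcongr
      _ = c * (5 * M) ^ (-p) := by rw [h2]
      _ ≤ c * (1 + N) ^ (-p) := mul_le_mul_of_nonneg_left h1 hc.le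
      _ ≤ 2 / (2 * j + 3) := hle
  rw [show c * ((1 / 5) * (M ^ q / M)) = c * M ^ q / (5 * M) by ring,
    div_le_div_iff₀ (by linarith) (by linarith)] at h3
  -- `h3 : c * M^q * (M - 2) ≤ 2 * (5 * M)`; with `M - 2 ≥ M/2`: `c M^q ≤ 20`
  have hMq : 0 ≤ M ^ q := Real.rpow_nonneg hM0.le q
  have h4 : c * M ^ q * (M / 2) ≤ c * M ^ q * (M - 2) :=
    mul_le_mul_of_nonneg_left (by linarith) (by positivity)
  have h5' : M ^ q ≤ 20 / c := by
    rw [le_div_iff₀ hc]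
    nlinarith
  have h6 : (20 / c) ^ q⁻¹ < M := by
    have : (j : ℝ) < M := by rw [hM]; linarith
    linarith
  have h7 : 20 / c < M ^ q := by
    have := Real.rpow_lt_rpow (Real.rpow_nonneg (by positivity) _) h6 hq0
    rwa [Real.rpow_inv_rpow (by positivity) hq0.ne'] at this
  linarith

end

end Summit.NavierStokesRegularity.NavierStokesRegularity.Theorems.SwirlHolderTower
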